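import Summits.HodgeConjecture.HodgeConjecture.Theorems.F0P3cStCharTSXIGAssembly      -- ★ p850653 (LH6-p03∕road (D)): the (S-X)′ organ `stXIGSt'` — the Δ‴-transfer `f^H` of the Hecke shell `𝟙_{K_n (z aᵐ) K_n}` and its value `Tr St_H(ξ_v)(f^H)`
import Summits.HodgeConjecture.HodgeConjecture.Theorems.F0P3cStCharTSShellsTT           -- ★ (LH6-p05): `integral_indicator_doubleCoset` — `∫ 𝟙_{K b K} dν = #R·ν(K)` read across the two carrier spellings
import Summits.HodgeConjecture.HodgeConjecture.Theorems.F0P3cStCharTSCasselmanCap     -- ★ p850760 (LH6-p05): `exists_level_doubleCoset_subset` (a shell shrinks to its centre), `integral_indicator_mul_eq_of_eqOn`; brings ★ StShellTrace, ★ Constants, ★ ShellKit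
import Summits.HodgeConjecture.HodgeConjecture.Theorems.F0P3cStCharTSBaseDiag          -- ★ (A-p16): `map_coe_central_mul_ray_pow` — the `w`-matrix of `z aᵐ` is `d(βαᵐ, β, β(σ_w α)⁻ᵐ)`
import Summits.HodgeConjecture.HodgeConjecture.Theorems.F0P3cStCharTSHyperbolicCore    -- ★ (F0P3a-p05): `mem_hyperbolicSet_of_one_lt_v_trace` (`1 < |tr γ|_w ⇒ γ` regular); brings ★ `one_lt_v_add_add_iff`
import Summits.HodgeConjecture.HodgeConjecture.Theorems.F0P3cStCharTSGShellData        -- ★ p849915 (LH6-p03): `exists_coe_localNonsplitEquiv_eq_smul_one_of_mem_center` (`E₃ z = β·1`, `|β|_w = 1`)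
import Literature.NumberTheory.Rogawski1990.Ch12Sec5                                    -- ★ TR carpet: `EllipticData.UpSpec` (the definition of `α ↦ α^G`, p. 183)
import Literature.NumberTheory.Rogawski1990.Ch12Sec5Inputs                              -- ★ sockets (M1H) `PacketCharHRegularity`, (UPR) `UpRegularity`
import Literature.NumberTheory.Rogawski1990.Ch12Sec5UpSpecLB                            -- ★ p852414 (F0P3-p02 g23): `EllipticData.UpSpecLB` — the locally-bounded reading of `UpSpec` (ED. 2, the `_LB` twin)
import HarnessLib

/-!
# F0 · P3c · line LH6 «StCharTS» — road (L1M-up), «UP-VALUE★»: THE TRANSPORTED PACKET CHARACTER `χ_ρ^G = (χ_{St_H(ξ_v)})^G` ON THE DEEP SPLIT TORUS,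
# POINTWISE, FROM THE TRANSFER IDENTITY `UpSpec` AND THE ★ FUNDAMENTAL-LEMMA VALUES (S-X) — WITHOUT LEMMA 12.5.1
# [Rogawski1990, §12.5 p. 183 (definition of `α^G`, Lemma 12.5.1); §12.7 Lemma 12.7.2 (proof) p. 193; Lemma 12.7.3 (proof) p. 195]

Cell `pub/hodgecm-mathlib`, crux H413 = `stmt-HodgeConjecture-24833` (lane `--supports … --as helper`), route HCCMUnconditional; seat F0P2-p06 (g16),
desk F0P3-plan (g15) deal 2026-09-02T09:14:52Z «(L1M-up) ROAD — H-SIDE CENSUS + FIRST BRICK» (census 09:20:33Z on the P3b bus; integrator LH6-p01 (g3)).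
THEOREMS ONLY (no definition, no instance, no notation, no named fact, no `sorry`); ★-only imports.  HONEST LABEL: HC_CM is proved only modulo the 7 printed
citations (2 remaining: hLiu418 = stmt-HodgeConjecture-24832, h413 = stmt-HodgeConjecture-24833) until rung 0 closes; count-neutral (the (DEC-up) clause of the
(TOR⁵) block of the (S-𝔇) organ `stub_EllipticPackage` of `Cruxes/H413/Lines/F0_P3c_StCharTSPaydown.lean` stays a socket until the integrator's edition folds this file).

THE MATHEMATICS.  `G = U(Φ₃)(L⁺_v)` (`v` non-split, `w ∣ v`), `H = U(Φ₂) × U(Φ₁)`, `ρ = {St_H(ξ_v)} ∈ Π²(H)`, `𝔇` the §12.5 datum of the (S-𝔇) organ with its COMPAT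
clauses (`μG = νQv`, `μH = νHv`, `regG ↔ IsRegularElt`, `IsTransfer ↔` the Δ‴_{Φ₃}-matching ★ `IsLocalDeltaTransfer`, `{πSt} ∈ Π²(H)`), the carpet `UpSpec`
(p. 183: `∫_G f·α^G = ∫_H f^H·α` for transfer pairs) and the sockets (M1H) (`χ_ρ` computes `Tr ρ`) and (UPR) (`χ_ρ^G` locally integrable and locally constant on
`G^{reg}`).  For the deep torus element `b = z·aᵐ` (`z` central, `a = d(α, 1, (σα)⁻¹)`, `0 < |α|_w < 1`, `m ≥ 1`) print computes (p. 193, with L. 12.5.1 p. 183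
on `M ⊂ H` — ONE `Ω_F(M,H)∖Ω_F(M,G)`-coset, `𝔇(M∕F) = 1` — and Prop. 4.9.1) `D_G(b)·χ_ρ^G(b) = τ(b)·D_H(b)·χ_ρ(b) = ξ(b)μ(α)‖α‖^{1/2}·‖α‖·‖α‖⁻¹…`, i.e.
**`χ_ρ^G(b) = δ_B^{1/2}(b)·χ_{ξ,μ}(b)`** (★ `rootDeltaChar`, ★ `cmXiTorusChar`).  HERE this value is obtained WITHOUT Lemma 12.5.1: the ★ (S-X)′ organ
(`F0P3cStCharTSXIGAssembly.stXIGSt'`, the fundamental lemma for the Hecke shells + Casselman on `H`) supplies, for every deep level `K_n`, a smooth Δ‴-transfer `f^H`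
of `𝟙_{K_n b K_n}` with `Tr St_H(ξ_v)(f^H) = ν(K_n)·#R·δ_B^{1/2}(b)·χ_{ξ,μ}(b)`; `UpSpec` at the pair (`𝟙_{K_n b K_n}`, `f^H`) and (M1H) give
`∫ 𝟙_{K_n b K_n}·χ_ρ^G dν = ∫ f^H·χ_ρ dν_H = Tr St_H(ξ_v)(f^H)`; (UPR) local constancy of `χ_ρ^G` at the REGULAR point `b` (its `w`-trace has valuation `|α|_w^{-m} > 1`,
★ `mem_hyperbolicSet_of_one_lt_v_trace`) and a shell shrunk into the constancy neighbourhood (★ `exists_level_doubleCoset_subset`) give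
`∫ 𝟙_{K_n b K_n}·χ_ρ^G dν = ν(K_n b K_n)·χ_ρ^G(b) = ν(K_n)·#R·χ_ρ^G(b)` (★ `measureReal_doubleCoset_eq_card_mul`); cancel `ν(K_n)·#R ≠ 0` (★ CONSTANTS).
This is CASSELMAN-CAP's skeleton (★ p850760) with the representation-theoretic shell trace `Tr σ(𝟙_{K_n b K_n})` replaced by the endoscopic one `Tr πSt(f^H)`.

## References
* [Rogawski1990] J. D. Rogawski, *Automorphic Representations of Unitary Groups in Three Variables*, Ann. of Math. Stud. 123 (1990): §4.9 Prop. 4.9.1 pp. 54–56; §12.5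
  p. 183 (`α^G`, Lemma 12.5.1); §12.7 Lemma 12.7.2 (proof) p. 193, Lemma 12.7.3 (proof) p. 195.
* [Casselman1995] W. Casselman, *Introduction to the theory of admissible representations of p-adic reductive groups* (1974∕1995): Prop. 1.4.4 p. 14.
-/

set_option autoImplicit false
-- the mandated namespace has the single-problem summit's repeated segment (`HodgeConjecture.HodgeConjecture`)
set_option linter.dupNamespace false

noncomputable section

open NumberField IsDedekindDomain MeasureTheory MeasureTheory.Measure Topology Filter
open scoped Matrix MatrixGroups WithZero Pointwise NNReal
open Literature.NumberTheory Literature.NumberTheory.Automorphic Literature.NumberTheory.Automorphic.UnitaryGroup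
open Literature.NumberTheory.GaloisRepresentations
open Literature.NumberTheory.Rogawski1990

namespace Summit.HodgeConjecture.HodgeConjecture.Cruxes.H413.F0P3cStCharTSUpValue

open Summit.HodgeConjecture.HodgeConjecture.Cruxes.H413

set_option maxHeartbeats 16000000 in
set_option synthInstance.maxHeartbeats 400000 in
-- the statement (≈ 60 lines of binders: the (S-X)′ organ's prefix + the datum block) exceeds the default budgets, as ★ `stXIGSt'` does
/-- **«UP-VALUE★» — `χ_ρ^G(z·aᵐ) = δ_B^{1/2}(z·aᵐ)·χ_{ξ,μ}(z·aᵐ)` for `ρ = {St_H(ξ_v)}`, at every deep diagonal point of the split torus of `U(Φ₃)(L⁺_v)`.**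
Binders: the (S-X)′ organ's prefix VERBATIM (`L μ ξ v`, `v` non-split, `μ` unitary with `μ|_{𝔸_{L⁺}} = ω_{L∕L⁺}`, the two carriers' Borel structures and Haar measures,
Borel quotient structures, CANONICAL orbital families, (T_v), the `H`-labels `(π₁, πSt)` of ★ `HLengthTwoLabels` with `π₁` pinned to `ξ_v`), then the §12.5 datum
`𝔇 : EllipticData (U(Φ₃)(L⁺_v)) (H_v)` with the consumed COMPAT clauses, `UpSpec`, (M1H), (UPR), then the (S-X)′ point data VERBATIM (`𝓘 z w α K₀` + the eleven package
clauses of ★ `exists_cmIwahoriDatum`).  Conclusion: for `m ≥ 1` with `z·𝓘.aᵐ ∈ T`, `𝔇.up (𝔇.packetCharH {πSt}) (z·𝓘.aᵐ) = rootDeltaChar(z·𝓘.aᵐ) · cmXiTorusChar(z·𝓘.aᵐ)`.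
[cite: Rogawski1990, §12.5 p. 183; §12.7 Lemma 12.7.2 (proof) p. 193; Lemma 12.7.3 (proof) p. 195] [cite: Casselman1995, Prop. 1.4.4 p. 14] -/
theorem up_packetCharH_central_mul_ray_pow :
      ∀ (L : Type) [Field L] [NumberField L] [IsCMField L] (μ : HeckeCharacter L) (ξ : OneDimAutRepH L) (v : HeightOneSpectrum (𝓞 ↥(maximalRealSubfield L))),
        (∀ w : PlacesOver L v, IsCMField.complexConj L • w.1 = w.1) → μ.IsUnitary →
        (∀ x : Literature.NumberTheory.GaloisRepresentations.ideleGroup ↥(maximalRealSubfield L),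
          μ (AdeleRing.ideleBaseChange (↥(maximalRealSubfield L)) L x) = quadraticHeckeCharCM L x) →
        ∀ [MeasurableSpace (((UnitaryGroup.cmDatum L 2 (Matrix.of fun i j : Fin 2 => if i.val + j.val + 1 = 2 then (1 : L) else 0)).Local v × (UnitaryGroup.cmDatum L 1 (Matrix.of fun i j : Fin 1 => if i.val + j.val + 1 = 1 then (1 : L) else 0)).Local v))] [BorelSpace (((UnitaryGroup.cmDatum L 2 (Matrix.of fun i j : Fin 2 => if i.val + j.val + 1 = 2 then (1 : L) else 0)).Local v × (UnitaryGroup.cmDatum L 1 (Matrix.of fun i j : Fin 1 => if i.val + j.val + 1 = 1 then (1 : L) else 0)).Local v))] [MeasurableSpace (Gqs L v)] [BorelSpace (Gqs L v)]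
          (νHv : Measure (((UnitaryGroup.cmDatum L 2 (Matrix.of fun i j : Fin 2 => if i.val + j.val + 1 = 2 then (1 : L) else 0)).Local v × (UnitaryGroup.cmDatum L 1 (Matrix.of fun i j : Fin 1 => if i.val + j.val + 1 = 1 then (1 : L) else 0)).Local v))) (νQv : Measure (Gqs L v))
          [νHv.IsHaarMeasure] [νHv.IsMulRightInvariant] [νQv.IsHaarMeasure] [νQv.IsMulRightInvariant],
        letI : ∀ a : ((UnitaryGroup.cmDatum L 2 (Matrix.of fun i j : Fin 2 => if i.val + j.val + 1 = 2 then (1 : L) else 0)).Local v × (UnitaryGroup.cmDatum L 1 (Matrix.of fun i j : Fin 1 => if i.val + j.val + 1 = 1 then (1 : L) else 0)).Local v), MeasurableSpace (((UnitaryGroup.cmDatum L 2 (Matrix.of fun i j : Fin 2 => if i.val + j.val + 1 = 2 then (1 : L) else 0)).Local v × (UnitaryGroup.cmDatum L 1 (Matrix.of fun i j : Fin 1 => if i.val + j.val + 1 = 1 then (1 : L) else 0)).Local v) ⧸ Subgroup.centralizer ({a} : Set (((UnitaryGroup.cmDatum L 2 (Matrix.of fun i j : Fin 2 => if i.val + j.val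 + 1 = 2 then (1 : L) else 0)).Local v × (UnitaryGroup.cmDatum L 1 (Matrix.of fun i j : Fin 1 => if i.val + j.val + 1 = 1 then (1 : L) else 0)).Local v)))) := fun _ => borel _
        haveI : ∀ a : ((UnitaryGroup.cmDatum L 2 (Matrix.of fun i j : Fin 2 => if i.val + j.val + 1 = 2 then (1 : L) else 0)).Local v × (UnitaryGroup.cmDatum L 1 (Matrix.of fun i j : Fin 1 => if i.val + j.val + 1 = 1 then (1 : L) else 0)).Local v), BorelSpace (((UnitaryGroup.cmDatum L 2 (Matrix.of fun i j : Fin 2 => if i.val + j.val + 1 = 2 then (1 : L) else 0)).Local v × (UnitaryGroup.cmDatum L 1 (Matrix.of fun i j : Fin 1 => if i.val + j.val + 1 = 1 then (1 : L) else 0)).Local v) ⧸ Subgroup.centralizer ({a} : Set (((UnitaryGroup.cmDatum L 2 (Matrix.of fun i j : Fin 2 => if i.val + j.val + 1 = 2 then (1 : L) else 0)).Local v × (UnitaryGroup.cmDatum L 1 (Matrix.of fun i j : Fin 1 => if i.val + j.val + 1 = 1 then (1 : L) else 0)).Local v)))) := fun _ => ⟨rfl⟩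
        letI : ∀ γ : Gqs L v, MeasurableSpace (Gqs L v ⧸ Subgroup.centralizer ({γ} : Set (Gqs L v))) := fun _ => borel _
        haveI : ∀ γ : Gqs L v, BorelSpace (Gqs L v ⧸ Subgroup.centralizer ({γ} : Set (Gqs L v))) := fun _ => ⟨rfl⟩
        ∀ (mHv : OrbitalMeasureFamily (((UnitaryGroup.cmDatum L 2 (Matrix.of fun i j : Fin 2 => if i.val + j.val + 1 = 2 then (1 : L) else 0)).Local v × (UnitaryGroup.cmDatum L 1 (Matrix.of fun i j : Fin 1 => if i.val + j.val + 1 = 1 then (1 : L) else 0)).Local v))) (mQv : OrbitalMeasureFamily (Gqs L v)),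
          mHv.IsCanonical (IsLocalGRegular L v) νHv →
          mQv.IsCanonical (fun γ => IsRegularElt (γ.val : GL (Fin 3) (UnitaryGroup.LocalRing L v))) νQv →
          IsLocalDeltaTransferExists L (qsForm L) v ((finExplicitCollection L (qsForm L) μ (finExplicitDelta_conj_left_all L (qsForm L) μ) (finExplicitDelta_conj_right_all L (qsForm L) μ)) v) mHv mQv IsLocSmooth IsLocSmooth →
          ∀ (π₁ πSt : IrrClass (((UnitaryGroup.cmDatum L 2 (Matrix.of fun i j : Fin 2 => if i.val + j.val + 1 = 2 then (1 : L) else 0)).Local v × (UnitaryGroup.cmDatum L 1 (Matrix.of fun i j : Fin 1 => if i.val + j.val + 1 = 1 then (1 : L) else 0)).Local v))),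
            HLengthTwoLabels L v
              (torusCharPair (conjLocal L (IsCMField.complexConj L) v) (cmLocalForm L 2 v) (cmLocalForm_eq_over L 2 v) 0
                ((torusLocalComponent L (IsCMField.complexConj L) v ξ.η).comp
                    (quotConj (conjLocal L (IsCMField.complexConj L) v) (conjLocal_conjLocal_cm L v)) *
                  halfModulusChar (UnitaryGroup.LocalRing L v))
                (torusLocalComponent L (IsCMField.complexConj L) v ξ.ψ))
              ((torusLocalComponent L (IsCMField.complexConj L) v ξ.ψ).comp (localDet (IsCMField.complexConj L) v (isUnit_antidiagOne_det L 1))) π₁ πSt →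
            (∀ fH : ((UnitaryGroup.cmDatum L 2 (Matrix.of fun i j : Fin 2 => if i.val + j.val + 1 = 2 then (1 : L) else 0)).Local v × (UnitaryGroup.cmDatum L 1 (Matrix.of fun i j : Fin 1 => if i.val + j.val + 1 = 1 then (1 : L) else 0)).Local v) → ℂ, IsLocSmooth fH → π₁.smoothTrace νHv fH = charDist (ξ.xiLocalChar v) νHv fH) →
          -- ══ the §12.5 datum (over the organ's Borel σ-algebra on `U(Φ₃)(L⁺_v) ⧸ Z`) and the package conjuncts consumed (COMPAT `hμG hμH hreg hTr hρ`; carpet `UpSpec`; sockets (M1H) (UPR)) ══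
          ∀ [MeasurableSpace (Gqs L v ⧸ Subgroup.center (Gqs L v))] [BorelSpace (Gqs L v ⧸ Subgroup.center (Gqs L v))],
          ∀ (𝔇 : Ch12Sec5.EllipticData (Gqs L v) ((UnitaryGroup.cmDatum L 2 (Matrix.of fun i j : Fin 2 => if i.val + j.val + 1 = 2 then (1 : L) else 0)).Local v × (UnitaryGroup.cmDatum L 1 (Matrix.of fun i j : Fin 1 => if i.val + j.val + 1 = 1 then (1 : L) else 0)).Local v)),
            𝔇.μG = νQv → 𝔇.μH = νHv →
            (∀ γ : Gqs L v, γ ∈ 𝔇.regG ↔ IsRegularElt (γ.val : GL (Fin 3) (UnitaryGroup.LocalRing L v))) →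
            (∀ (φ : Gqs L v → ℂ) (fH : ((UnitaryGroup.cmDatum L 2 (Matrix.of fun i j : Fin 2 => if i.val + j.val + 1 = 2 then (1 : L) else 0)).Local v × (UnitaryGroup.cmDatum L 1 (Matrix.of fun i j : Fin 1 => if i.val + j.val + 1 = 1 then (1 : L) else 0)).Local v) → ℂ), 𝔇.IsTransfer φ fH ↔ IsLocalDeltaTransfer L (qsForm L) v ((finExplicitCollection L (qsForm L) μ (finExplicitDelta_conj_left_all L (qsForm L) μ) (finExplicitDelta_conj_right_all L (qsForm L) μ)) v) mHv mQv fH φ) →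
            ({πSt} : Finset (IrrClass ((UnitaryGroup.cmDatum L 2 (Matrix.of fun i j : Fin 2 => if i.val + j.val + 1 = 2 then (1 : L) else 0)).Local v × (UnitaryGroup.cmDatum L 1 (Matrix.of fun i j : Fin 1 => if i.val + j.val + 1 = 1 then (1 : L) else 0)).Local v))) ∈ 𝔇.sqPacketsH →
            𝔇.UpSpec → 𝔇.PacketCharHRegularity → 𝔇.UpRegularity →
          haveI := locallyCompactSpace_cmBorelU L 3 v
          ∀ (𝓘 : (cmBorelTriple L 3 v).IwahoriDatum) (z : ↥(unitaryGroupOfForm (conjLocal L (IsCMField.complexConj L) v) (cmLocalForm L 3 v))),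
            z ∈ Subgroup.center ↥(unitaryGroupOfForm (conjLocal L (IsCMField.complexConj L) v) (cmLocalForm L 3 v)) →
          ∀ (w : PlacesOver L v) (hw : IsCMField.complexConj L • w.1 = w.1) (α : w.1.adicCompletion L), α ≠ 0 → Valued.v α < 1 →
            ((((localNonsplitEquiv (IsCMField.complexConj L) (Rogawski1990.qsForm L) (IsCMField.complexConj_ne_one L) w hw) 𝓘.a : ↥(unitaryGroupOfForm (galAdicCompletionMap (L := L) (IsCMField.complexConj L) hw) (placeForm (Rogawski1990.qsForm L) w.1))) :
                GL (Fin 3) (w.1.adicCompletion L)) : Matrix (Fin 3) (Fin 3) (w.1.adicCompletion L)) = Matrix.diagonal ![α, 1, ((galAdicCompletionMap (L := L) (IsCMField.complexConj L) hw) α)⁻¹] →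
            ∀ (K₀ : Subgroup ↥(unitaryGroupOfForm (conjLocal L (IsCMField.complexConj L) v) (cmLocalForm L 3 v))),
            IsCompact (K₀ : Set ↥(unitaryGroupOfForm (conjLocal L (IsCMField.complexConj L) v) (cmLocalForm L 3 v))) → IsOpen (K₀ : Set ↥(unitaryGroupOfForm (conjLocal L (IsCMField.complexConj L) v) (cmLocalForm L 3 v))) →
            Subgroup.center ↥(unitaryGroupOfForm (conjLocal L (IsCMField.complexConj L) v) (cmLocalForm L 3 v)) ≤ K₀ → (∀ n, 𝓘.K n ≤ K₀) →
            (∀ n, ∀ k ∈ K₀, ∀ κ ∈ 𝓘.K n, k⁻¹ * κ * k ∈ 𝓘.K n) →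
            (∀ n, ∀ x ∈ 𝓘.K n ⊓ (cmBorelTriple L 3 v).N, 𝓘.a * x * 𝓘.a⁻¹ ∈ 𝓘.K n) →
            (∀ n, ∀ x ∈ 𝓘.K n ⊓ 𝓘.Nbar, 𝓘.a⁻¹ * x * 𝓘.a ∈ 𝓘.K n ⊓ 𝓘.Nbar) →
            (∀ n, ∀ x ∈ (cmBorelTriple L 3 v).N, ∃ m : ℕ, ∀ m', m ≤ m' → 𝓘.a ^ m' * x * (𝓘.a ^ m')⁻¹ ∈ 𝓘.K n) →
            (∀ nb ∈ 𝓘.Nbar, ∀ m ∈ (cmBorelTriple L 3 v).M, ∀ n ∈ (cmBorelTriple L 3 v).N, ∀ nb' ∈ 𝓘.Nbar, ∀ m' ∈ (cmBorelTriple L 3 v).M,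
                ∀ n' ∈ (cmBorelTriple L 3 v).N, nb * m * n = nb' * m' * n' → n = n') →
            (∀ n, Pairwise (Function.onFun Disjoint fun m : ℕ =>
                (QuotientGroup.mk : ↥(unitaryGroupOfForm (conjLocal L (IsCMField.complexConj L) v) (cmLocalForm L 3 v)) → ↥(unitaryGroupOfForm (conjLocal L (IsCMField.complexConj L) v) (cmLocalForm L 3 v)) ⧸ Subgroup.center ↥(unitaryGroupOfForm (conjLocal L (IsCMField.complexConj L) v) (cmLocalForm L 3 v))) '' DoubleCoset.doubleCoset (𝓘.a ^ m) (𝓘.K n : Set ↥(unitaryGroupOfForm (conjLocal L (IsCMField.complexConj L) v) (cmLocalForm L 3 v))) (𝓘.K n))) →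
            (∀ k : ↥(unitaryGroupOfForm (conjLocal L (IsCMField.complexConj L) v) (cmLocalForm L 3 v)), k ∈ K₀ ↔ ((((localNonsplitEquiv (IsCMField.complexConj L) (Rogawski1990.qsForm L) (IsCMField.complexConj_ne_one L) w hw) k : ↥(unitaryGroupOfForm (galAdicCompletionMap (L := L) (IsCMField.complexConj L) hw) (placeForm (Rogawski1990.qsForm L) w.1))) : GL (Fin 3) (w.1.adicCompletion L)) ∈ glInt 3 (w.1.adicCompletion L))) →
            ∀ m : ℕ, 1 ≤ m → ∀ (hbM : z * 𝓘.a ^ m ∈ (cmBorelTriple L 3 v).M),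
              𝔇.up (𝔇.packetCharH {πSt}) ((z * 𝓘.a ^ m : ↥(unitaryGroupOfForm (conjLocal L (IsCMField.complexConj L) v) (cmLocalForm L 3 v))) : Gqs L v) =
                ((rootDeltaChar (cmBorelTriple L 3 v).P (Subgroup.inclusion (cmBorelTriple L 3 v).M_le ⟨z * 𝓘.a ^ m, hbM⟩) : ℂˣ) : ℂ) *
                  (((cmXiTorusChar L v (μ.semilocalComponent L v) (torusLocalComponent L (IsCMField.complexConj L) v ξ.η) (torusLocalComponent L (IsCMField.complexConj L) v ξ.ψ)) ⟨z * 𝓘.a ^ m, hbM⟩ : ℂˣ) : ℂ) := by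
  intro L _ _ _ μ ξ v hns hμu hμω _ _ _ _ νHv νQv _ _ _ _ mHv mQv hcH hcQ hTv π₁ πSt hlab hπ₁ _ _ 𝔇 hμG hμH hreg hTr hρ hUp hHCH hUpReg
    𝓘 z hzc w hw α hα0 hα1 ha K₀ hK₀c hK₀o hZK₀ hKK₀ hnormK₀ haN haNbar hexh huniq hdisj hK₀E m hm hbM
  -- the organ's Borel quotient σ-algebras, re-installed as local instances (as in ★ ₄)
  letI : ∀ γ : Gqs L v, MeasurableSpace (Gqs L v ⧸ Subgroup.centralizer ({γ} : Set (Gqs L v))) := fun _ => borel _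
  haveI : ∀ γ : Gqs L v, BorelSpace (Gqs L v ⧸ Subgroup.centralizer ({γ} : Set (Gqs L v))) := fun _ => ⟨rfl⟩
  -- ═══ (1) the (S-X)′ organ at this package: a neighbourhood `U` of `1` below which every level carries a transfer `f^H` of the shell with its trace value ═══
  obtain ⟨U, hU, hXIG⟩ := F0P3cStCharTSXIGAssembly.stXIGSt' L μ ξ v hns hμu hμω νHv νQv mHv mQv hcH hcQ hTv π₁ πSt hlab hπ₁
    𝓘 z hzc w hw α hα0 hα1 ha K₀ hK₀c hK₀o hZK₀ hKK₀ hnormK₀ haN haNbar hexh huniq hdisj hK₀E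
  set b : ↥(unitaryGroupOfForm (conjLocal L (IsCMField.complexConj L) v) (cmLocalForm L 3 v)) := z * 𝓘.a ^ m with hbdef
  -- ═══ (2) `b := z·𝓘.aᵐ` is REGULAR: its `w`-trace `β(αᵐ + 1 + (σ_w α)⁻ᵐ)` has valuation `|α|_w⁻ᵐ > 1` (★ B-DIAG + ★ `one_lt_v_add_add_iff`), so `b ∈ hyperbolicSet ⊆ G^{reg}` ═══
  obtain ⟨β, hzβ, hβ, -⟩ := F0P3cStCharTSGShellData.exists_coe_localNonsplitEquiv_eq_smul_one_of_mem_center L v w hw hzc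
  have hmap := F0P3cStCharTSBaseDiag.map_coe_central_mul_ray_pow L v w hw hzβ ha m
  have hvα0 : Valued.v α ≠ 0 := (Valuation.ne_zero_iff _).2 hα0
  have hσv : Valued.v ((galAdicCompletionMap (L := L) (IsCMField.complexConj L) hw) α) = Valued.v α :=
    valued_galAdicCompletionMap (L := L) (IsCMField.complexConj L) hw α
  have hm0 : m ≠ 0 := Nat.one_le_iff_ne_zero.1 hm
  have htr : (Pi.evalRingHom (fun w' : PlacesOver L v => w'.1.adicCompletion L) w)
      (Matrix.trace (((b : GL (Fin 3) (LocalRing L v)) : Matrix (Fin 3) (Fin 3) (LocalRing L v)))) =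
        β * α ^ m + β + β * ((galAdicCompletionMap (L := L) (IsCMField.complexConj L) hw) α)⁻¹ ^ m := by
    rw [AddMonoidHom.map_trace, hbdef, hmap, Matrix.trace_fin_three]
    simp [Matrix.diagonal_apply_eq]
  have hvtr : 1 < Valued.v ((Pi.evalRingHom (fun w' : PlacesOver L v => w'.1.adicCompletion L) w)
      (Matrix.trace (((b : GL (Fin 3) (LocalRing L v)) : Matrix (Fin 3) (Fin 3) (LocalRing L v))))) := by
    rw [htr]
    refine (F0P3cStCharTSHyperbolicSet.one_lt_v_add_add_iff L v (a := Valued.v α ^ m) (pow_ne_zero _ hvα0) ?_ hβ ?_).2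
      (ne_of_lt (pow_lt_one₀ zero_le hα1 hm0))
    · rw [map_mul, map_pow, hβ, one_mul]
    · rw [map_mul, map_pow, map_inv₀, hσv, hβ, one_mul, inv_pow]
  have hbreg : ((b : ↥(unitaryGroupOfForm (conjLocal L (IsCMField.complexConj L) v) (cmLocalForm L 3 v))) : Gqs L v) ∈ 𝔇.regG :=
    (hreg _).2 (F0P3cStCharTSHyperbolicCore.mem_hyperbolicSet_of_one_lt_v_trace L v hns w _ hvtr).2
  -- ═══ (3) (UPR): `χ_ρ^G` is locally constant at `b`; a level whose shell lies in the constancy neighbourhood and below `U` (★ CAP's shrinking lemma) ═══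
  obtain ⟨W, hW, hΘW⟩ := ((hUpReg {πSt} hρ).2 _ hbreg).exists_mem
  obtain ⟨n, hnU, hnW⟩ := F0P3cStCharTSCasselmanCap.exists_level_doubleCoset_subset (cmBorelTriple L 3 v) 𝓘 b hW hU
  -- ═══ (4) a left transversal of `K_n ∕ (K_n ∩ ᵇK_n)` and the (S-X)′ transfer at that level ═══
  obtain ⟨R, hR⟩ := Representation.exists_isLeftTransversal_conj (𝓘.isCompact_K n) (𝓘.isOpen_K n) b
  obtain ⟨fH, hfH, htrans, hval⟩ := hXIG n hnU m hm hbM R hR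
  -- ═══ (5) `UpSpec` at the transfer pair + (M1H) at the singleton packet: `∫ 𝟙_{K_n b K_n}·χ_ρ^G dν = ∫ f^H·χ_ρ dν_H = Tr πSt(f^H)` (★ ₄'s (HM) block) ═══
  obtain ⟨hmeasH, hliH, hstH, -, htrH⟩ := hHCH {πSt} hρ
  obtain ⟨-, -, hupId⟩ := hUp (𝔇.packetCharH {πSt}) hmeasH hstH
  set D : Set ↥(unitaryGroupOfForm (conjLocal L (IsCMField.complexConj L) v) (cmLocalForm L 3 v)) :=
    DoubleCoset.doubleCoset b (𝓘.K n : Set ↥(unitaryGroupOfForm (conjLocal L (IsCMField.complexConj L) v) (cmLocalForm L 3 v))) (𝓘.K n) with hDdef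
  have hDo : IsOpen D := (𝓘.isOpen_K n).mul_left
  have hDc : IsCompact D := ((𝓘.isCompact_K n).mul isCompact_singleton).mul (𝓘.isCompact_K n)
  -- the shell read on the organ carrier `Gqs L v` (same set, same topology ∕ σ-algebra — pinned once, as in ★ SHELLS-TT)
  have hDoG : @IsOpen (Gqs L v) _ D := hDo
  have hDm : @MeasurableSet (Gqs L v) _ D := hDoG.measurableSet
  set φ : Gqs L v → ℂ := D.indicator (fun _ => (1 : ℂ)) with hφdef
  have hφ : IsLocSmooth φ := isLocSmooth_indicator hDo hDc.isClosed hDc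
  have h1 : πSt.smoothTrace νHv fH = ∫ h, fH h * 𝔇.packetCharH {πSt} h ∂𝔇.μH := by
    have h := htrH fH hfH
    rw [Finset.sum_singleton, hμH] at h
    rw [hμH]; exact h
  have hintG : Integrable (fun g => φ g * 𝔇.up (𝔇.packetCharH {πSt}) g) 𝔇.μG := by
    simpa only [smul_eq_mul] using (hUpReg {πSt} hρ).1.integrable_smul_left_of_hasCompactSupport hφ.1.continuous hφ.2
  have hintH : Integrable (fun h => fH h * 𝔇.packetCharH {πSt} h) 𝔇.μH := by
    simpa only [smul_eq_mul] using hliH.integrable_smul_left_of_hasCompactSupport hfH.1.continuous hfH.2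
  have h2 := hupId φ hφ fH ((hTr φ fH).mpr htrans) hintG hintH
  have hkey : ∫ g, φ g * 𝔇.up (𝔇.packetCharH {πSt}) g ∂νQv = πSt.smoothTrace νHv fH := by
    rw [h1, ← h2, hμG]
  -- ═══ (6) the same integral by local constancy: `= ν(K_n b K_n)·χ_ρ^G(b)` (★ CAP `integral_indicator_mul_eq_of_eqOn`), and the shell mass `ν(K_n b K_n) = #R·ν(K_n)` (★ SHELLS-TT) ═══
  have hconst : ∫ g, φ g * 𝔇.up (𝔇.packetCharH {πSt}) g ∂νQv =
      (νQv.real D : ℂ) * 𝔇.up (𝔇.packetCharH {πSt}) ((b : ↥(unitaryGroupOfForm (conjLocal L (IsCMField.complexConj L) v) (cmLocalForm L 3 v))) : Gqs L v) :=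
    F0P3cStCharTSCasselmanCap.integral_indicator_mul_eq_of_eqOn νQv hDm _ _ (fun g hg => hΘW g (hnW hg))
  have hone : ∫ g, φ g * (fun _ : Gqs L v => (1 : ℂ)) g ∂νQv = (νQv.real D : ℂ) * (fun _ : Gqs L v => (1 : ℂ)) ((b : ↥(unitaryGroupOfForm (conjLocal L (IsCMField.complexConj L) v) (cmLocalForm L 3 v))) : Gqs L v) :=
    F0P3cStCharTSCasselmanCap.integral_indicator_mul_eq_of_eqOn νQv hDm (fun _ : Gqs L v => (1 : ℂ)) ((b : ↥(unitaryGroupOfForm (conjLocal L (IsCMField.complexConj L) v) (cmLocalForm L 3 v))) : Gqs L v) (fun _ _ => rfl)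
  simp only [mul_one] at hone
  have hmass : ∫ g, φ g ∂νQv = (R.card : ℂ) * ((νQv.real ((𝓘.K n : Set ↥(unitaryGroupOfForm (conjLocal L (IsCMField.complexConj L) v) (cmLocalForm L 3 v))) : Set (Gqs L v)) : ℝ) : ℂ) :=
    F0P3cStCharTSShellsTT.integral_indicator_doubleCoset L v νQv (𝓘.K n) (𝓘.isOpen_K n) b hR
  rw [hmass] at hone
  rw [← hone] at hconst
  -- ═══ (7) compare with the (S-X)′ value and cancel `#R·ν(K_n) ≠ 0` (★ CONSTANTS) ═══
  rw [hconst, hval] at hkey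
  have hK : ((νQv.real ((𝓘.K n : Set ↥(unitaryGroupOfForm (conjLocal L (IsCMField.complexConj L) v) (cmLocalForm L 3 v))) : Set (Gqs L v)) : ℝ) : ℂ) ≠ 0 :=
    F0P3cStCharTSConstants.ofReal_measureReal_coe_subgroup_ne_zero νQv (𝓘.K n) (𝓘.isOpen_K n) (𝓘.isCompact_K n)
  have hRc : (R.card : ℂ) ≠ 0 := F0P3cStCharTSConstants.natCast_card_ne_zero_of_isLeftTransversal hR
  have hcancel : ∀ {x d c : ℂ},
      (R.card : ℂ) * ((νQv.real ((𝓘.K n : Set ↥(unitaryGroupOfForm (conjLocal L (IsCMField.complexConj L) v) (cmLocalForm L 3 v))) : Set (Gqs L v)) : ℝ) : ℂ) * x =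
        ((νQv.real ((𝓘.K n : Set ↥(unitaryGroupOfForm (conjLocal L (IsCMField.complexConj L) v) (cmLocalForm L 3 v))) : Set (Gqs L v)) : ℝ) : ℂ) * (R.card : ℂ) * d * c → x = d * c :=
    fun h => mul_left_cancel₀ (mul_ne_zero hRc hK) (by rw [h]; ring)
  exact hcancel hkey

/-! ## (ED. 2) The `_LB` twin — the same value from the LOCALLY-BOUNDED carpet reading ★ `UpSpecLB` + Harish-Chandra's bound on `H` at `ρ` -/

set_option maxHeartbeats 16000000 in
set_option synthInstance.maxHeartbeats 400000 in
-- the statement (≈ 60 lines of binders: the (S-X)′ organ's prefix + the datum block) exceeds the default budgets, as ★ `stXIGSt'` does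
/-- **«UP-VALUE★», `_LB` twin (ROAD «UP-TR» DEAL #4 (D4-6); guard γ: ★ `up_packetCharH_central_mul_ray_pow` untouched)** — `χ_ρ^G(z·aᵐ) = δ_B^{1/2}(z·aᵐ)·χ_{ξ,μ}(z·aᵐ)`
for `ρ = {St_H(ξ_v)}` at every deep diagonal point of the split torus of `U(Φ₃)(L⁺_v)`, with the carpet hypothesis WEAKENED to ★ `UpSpecLB` (the locally-bounded reading of
p. 183, ★ p852414) plus — since the body DESTRUCTURES clause 3 at `α = χ_ρ` — its local-boundedness antecedent at that `α` as ONE extra binder placed right after it: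
`∀ C` compact `∃ B`, `‖D_H(s)·χ_ρ(s)‖ ≤ B` for `s ∈ C ∩ H^r` (Harish-Chandra on `H`; the junction's ★ `hHBHP` pin at `ρ = {πSt}`).  Every other binder and the conclusion =
★ UP-VALUE token for token; the body is ★'s by paste with `hupId hρB` for `hupId`.
[cite: Rogawski1990, §12.5 p. 183; §12.7 Lemma 12.7.2 (proof) p. 193; Lemma 12.7.3 (proof) p. 195] [cite: Casselman1995, Prop. 1.4.4 p. 14] -/
theorem up_packetCharH_central_mul_ray_pow_LB :
      ∀ (L : Type) [Field L] [NumberField L] [IsCMField L] (μ : HeckeCharacter L) (ξ : OneDimAutRepH L) (v : HeightOneSpectrum (𝓞 ↥(maximalRealSubfield L))),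
        (∀ w : PlacesOver L v, IsCMField.complexConj L • w.1 = w.1) → μ.IsUnitary →
        (∀ x : Literature.NumberTheory.GaloisRepresentations.ideleGroup ↥(maximalRealSubfield L),
          μ (AdeleRing.ideleBaseChange (↥(maximalRealSubfield L)) L x) = quadraticHeckeCharCM L x) →
        ∀ [MeasurableSpace (((UnitaryGroup.cmDatum L 2 (Matrix.of fun i j : Fin 2 => if i.val + j.val + 1 = 2 then (1 : L) else 0)).Local v × (UnitaryGroup.cmDatum L 1 (Matrix.of fun i j : Fin 1 => if i.val + j.val + 1 = 1 then (1 : L) else 0)).Local v))] [BorelSpace (((UnitaryGroup.cmDatum L 2 (Matrix.of fun i j : Fin 2 => if i.val + j.val + 1 = 2 then (1 : L) else 0)).Local v × (UnitaryGroup.cmDatum L 1 (Matrix.of fun i j : Fin 1 => if i.val + j.val + 1 = 1 then (1 : L) else 0)).Local v))] [MeasurableSpace (Gqs L v)] [BorelSpace (Gqs L v)]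
          (νHv : Measure (((UnitaryGroup.cmDatum L 2 (Matrix.of fun i j : Fin 2 => if i.val + j.val + 1 = 2 then (1 : L) else 0)).Local v × (UnitaryGroup.cmDatum L 1 (Matrix.of fun i j : Fin 1 => if i.val + j.val + 1 = 1 then (1 : L) else 0)).Local v))) (νQv : Measure (Gqs L v))
          [νHv.IsHaarMeasure] [νHv.IsMulRightInvariant] [νQv.IsHaarMeasure] [νQv.IsMulRightInvariant],
        letI : ∀ a : ((UnitaryGroup.cmDatum L 2 (Matrix.of fun i j : Fin 2 => if i.val + j.val + 1 = 2 then (1 : L) else 0)).Local v × (UnitaryGroup.cmDatum L 1 (Matrix.of fun i j : Fin 1 => if i.val + j.val + 1 = 1 then (1 : L) else 0)).Local v), MeasurableSpace (((UnitaryGroup.cmDatum L 2 (Matrix.of fun i j : Fin 2 => if i.val + j.val + 1 = 2 then (1 : L) else 0)).Local v × (UnitaryGroup.cmDatum L 1 (Matrix.of fun i j : Fin 1 => if i.val + j.val + 1 = 1 then (1 : L) else 0)).Local v) ⧸ Subgroup.centralizer ({a} : Set (((UnitaryGroup.cmDatum L 2 (Matrix.of fun i j : Fin 2 => if i.val + j.val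 + 1 = 2 then (1 : L) else 0)).Local v × (UnitaryGroup.cmDatum L 1 (Matrix.of fun i j : Fin 1 => if i.val + j.val + 1 = 1 then (1 : L) else 0)).Local v)))) := fun _ => borel _
        haveI : ∀ a : ((UnitaryGroup.cmDatum L 2 (Matrix.of fun i j : Fin 2 => if i.val + j.val + 1 = 2 then (1 : L) else 0)).Local v × (UnitaryGroup.cmDatum L 1 (Matrix.of fun i j : Fin 1 => if i.val + j.val + 1 = 1 then (1 : L) else 0)).Local v), BorelSpace (((UnitaryGroup.cmDatum L 2 (Matrix.of fun i j : Fin 2 => if i.val + j.val + 1 = 2 then (1 : L) else 0)).Local v × (UnitaryGroup.cmDatum L 1 (Matrix.of fun i j : Fin 1 => if i.val + j.val + 1 = 1 then (1 : L) else 0)).Local v) ⧸ Subgroup.centralizer ({a} : Set (((UnitaryGroup.cmDatum L 2 (Matrix.of fun i j : Fin 2 => if i.val + j.val + 1 = 2 then (1 : L) else 0)).Local v × (UnitaryGroup.cmDatum L 1 (Matrix.of fun i j : Fin 1 => if i.val + j.val + 1 = 1 then (1 : L) else 0)).Local v)))) := fun _ => ⟨rfl⟩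
        letI : ∀ γ : Gqs L v, MeasurableSpace (Gqs L v ⧸ Subgroup.centralizer ({γ} : Set (Gqs L v))) := fun _ => borel _
        haveI : ∀ γ : Gqs L v, BorelSpace (Gqs L v ⧸ Subgroup.centralizer ({γ} : Set (Gqs L v))) := fun _ => ⟨rfl⟩
        ∀ (mHv : OrbitalMeasureFamily (((UnitaryGroup.cmDatum L 2 (Matrix.of fun i j : Fin 2 => if i.val + j.val + 1 = 2 then (1 : L) else 0)).Local v × (UnitaryGroup.cmDatum L 1 (Matrix.of fun i j : Fin 1 => if i.val + j.val + 1 = 1 then (1 : L) else 0)).Local v))) (mQv : OrbitalMeasureFamily (Gqs L v)),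
          mHv.IsCanonical (IsLocalGRegular L v) νHv →
          mQv.IsCanonical (fun γ => IsRegularElt (γ.val : GL (Fin 3) (UnitaryGroup.LocalRing L v))) νQv →
          IsLocalDeltaTransferExists L (qsForm L) v ((finExplicitCollection L (qsForm L) μ (finExplicitDelta_conj_left_all L (qsForm L) μ) (finExplicitDelta_conj_right_all L (qsForm L) μ)) v) mHv mQv IsLocSmooth IsLocSmooth →
          ∀ (π₁ πSt : IrrClass (((UnitaryGroup.cmDatum L 2 (Matrix.of fun i j : Fin 2 => if i.val + j.val + 1 = 2 then (1 : L) else 0)).Local v × (UnitaryGroup.cmDatum L 1 (Matrix.of fun i j : Fin 1 => if i.val + j.val + 1 = 1 then (1 : L) else 0)).Local v))),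
            HLengthTwoLabels L v
              (torusCharPair (conjLocal L (IsCMField.complexConj L) v) (cmLocalForm L 2 v) (cmLocalForm_eq_over L 2 v) 0
                ((torusLocalComponent L (IsCMField.complexConj L) v ξ.η).comp
                    (quotConj (conjLocal L (IsCMField.complexConj L) v) (conjLocal_conjLocal_cm L v)) *
                  halfModulusChar (UnitaryGroup.LocalRing L v))
                (torusLocalComponent L (IsCMField.complexConj L) v ξ.ψ))
              ((torusLocalComponent L (IsCMField.complexConj L) v ξ.ψ).comp (localDet (IsCMField.complexConj L) v (isUnit_antidiagOne_det L 1))) π₁ πSt →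
            (∀ fH : ((UnitaryGroup.cmDatum L 2 (Matrix.of fun i j : Fin 2 => if i.val + j.val + 1 = 2 then (1 : L) else 0)).Local v × (UnitaryGroup.cmDatum L 1 (Matrix.of fun i j : Fin 1 => if i.val + j.val + 1 = 1 then (1 : L) else 0)).Local v) → ℂ, IsLocSmooth fH → π₁.smoothTrace νHv fH = charDist (ξ.xiLocalChar v) νHv fH) →
          -- ══ the §12.5 datum (over the organ's Borel σ-algebra on `U(Φ₃)(L⁺_v) ⧸ Z`) and the package conjuncts consumed (COMPAT `hμG hμH hreg hTr hρ`; carpet `UpSpec`; sockets (M1H) (UPR)) ══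
          ∀ [MeasurableSpace (Gqs L v ⧸ Subgroup.center (Gqs L v))] [BorelSpace (Gqs L v ⧸ Subgroup.center (Gqs L v))],
          ∀ (𝔇 : Ch12Sec5.EllipticData (Gqs L v) ((UnitaryGroup.cmDatum L 2 (Matrix.of fun i j : Fin 2 => if i.val + j.val + 1 = 2 then (1 : L) else 0)).Local v × (UnitaryGroup.cmDatum L 1 (Matrix.of fun i j : Fin 1 => if i.val + j.val + 1 = 1 then (1 : L) else 0)).Local v)),
            𝔇.μG = νQv → 𝔇.μH = νHv →
            (∀ γ : Gqs L v, γ ∈ 𝔇.regG ↔ IsRegularElt (γ.val : GL (Fin 3) (UnitaryGroup.LocalRing L v))) →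
            (∀ (φ : Gqs L v → ℂ) (fH : ((UnitaryGroup.cmDatum L 2 (Matrix.of fun i j : Fin 2 => if i.val + j.val + 1 = 2 then (1 : L) else 0)).Local v × (UnitaryGroup.cmDatum L 1 (Matrix.of fun i j : Fin 1 => if i.val + j.val + 1 = 1 then (1 : L) else 0)).Local v) → ℂ), 𝔇.IsTransfer φ fH ↔ IsLocalDeltaTransfer L (qsForm L) v ((finExplicitCollection L (qsForm L) μ (finExplicitDelta_conj_left_all L (qsForm L) μ) (finExplicitDelta_conj_right_all L (qsForm L) μ)) v) mHv mQv fH φ) →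
            ({πSt} : Finset (IrrClass ((UnitaryGroup.cmDatum L 2 (Matrix.of fun i j : Fin 2 => if i.val + j.val + 1 = 2 then (1 : L) else 0)).Local v × (UnitaryGroup.cmDatum L 1 (Matrix.of fun i j : Fin 1 => if i.val + j.val + 1 = 1 then (1 : L) else 0)).Local v))) ∈ 𝔇.sqPacketsH →
            𝔇.UpSpecLB →
            (∀ C : Set ((UnitaryGroup.cmDatum L 2 (Matrix.of fun i j : Fin 2 => if i.val + j.val + 1 = 2 then (1 : L) else 0)).Local v × (UnitaryGroup.cmDatum L 1 (Matrix.of fun i j : Fin 1 => if i.val + j.val + 1 = 1 then (1 : L) else 0)).Local v), IsCompact C → ∃ B : ℝ, ∀ s ∈ C, s ∈ 𝔇.regH → ‖(𝔇.DH s : ℂ) * 𝔇.packetCharH {πSt} s‖ ≤ B) →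
            𝔇.PacketCharHRegularity → 𝔇.UpRegularity →
          haveI := locallyCompactSpace_cmBorelU L 3 v
          ∀ (𝓘 : (cmBorelTriple L 3 v).IwahoriDatum) (z : ↥(unitaryGroupOfForm (conjLocal L (IsCMField.complexConj L) v) (cmLocalForm L 3 v))),
            z ∈ Subgroup.center ↥(unitaryGroupOfForm (conjLocal L (IsCMField.complexConj L) v) (cmLocalForm L 3 v)) →
          ∀ (w : PlacesOver L v) (hw : IsCMField.complexConj L • w.1 = w.1) (α : w.1.adicCompletion L), α ≠ 0 → Valued.v α < 1 →
            ((((localNonsplitEquiv (IsCMField.complexConj L) (Rogawski1990.qsForm L) (IsCMField.complexConj_ne_one L) w hw) 𝓘.a : ↥(unitaryGroupOfForm (galAdicCompletionMap (L := L) (IsCMField.complexConj L) hw) (placeForm (Rogawski1990.qsForm L) w.1))) :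
                GL (Fin 3) (w.1.adicCompletion L)) : Matrix (Fin 3) (Fin 3) (w.1.adicCompletion L)) = Matrix.diagonal ![α, 1, ((galAdicCompletionMap (L := L) (IsCMField.complexConj L) hw) α)⁻¹] →
            ∀ (K₀ : Subgroup ↥(unitaryGroupOfForm (conjLocal L (IsCMField.complexConj L) v) (cmLocalForm L 3 v))),
            IsCompact (K₀ : Set ↥(unitaryGroupOfForm (conjLocal L (IsCMField.complexConj L) v) (cmLocalForm L 3 v))) → IsOpen (K₀ : Set ↥(unitaryGroupOfForm (conjLocal L (IsCMField.complexConj L) v) (cmLocalForm L 3 v))) →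
            Subgroup.center ↥(unitaryGroupOfForm (conjLocal L (IsCMField.complexConj L) v) (cmLocalForm L 3 v)) ≤ K₀ → (∀ n, 𝓘.K n ≤ K₀) →
            (∀ n, ∀ k ∈ K₀, ∀ κ ∈ 𝓘.K n, k⁻¹ * κ * k ∈ 𝓘.K n) →
            (∀ n, ∀ x ∈ 𝓘.K n ⊓ (cmBorelTriple L 3 v).N, 𝓘.a * x * 𝓘.a⁻¹ ∈ 𝓘.K n) →
            (∀ n, ∀ x ∈ 𝓘.K n ⊓ 𝓘.Nbar, 𝓘.a⁻¹ * x * 𝓘.a ∈ 𝓘.K n ⊓ 𝓘.Nbar) →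
            (∀ n, ∀ x ∈ (cmBorelTriple L 3 v).N, ∃ m : ℕ, ∀ m', m ≤ m' → 𝓘.a ^ m' * x * (𝓘.a ^ m')⁻¹ ∈ 𝓘.K n) →
            (∀ nb ∈ 𝓘.Nbar, ∀ m ∈ (cmBorelTriple L 3 v).M, ∀ n ∈ (cmBorelTriple L 3 v).N, ∀ nb' ∈ 𝓘.Nbar, ∀ m' ∈ (cmBorelTriple L 3 v).M,
                ∀ n' ∈ (cmBorelTriple L 3 v).N, nb * m * n = nb' * m' * n' → n = n') →
            (∀ n, Pairwise (Function.onFun Disjoint fun m : ℕ =>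
                (QuotientGroup.mk : ↥(unitaryGroupOfForm (conjLocal L (IsCMField.complexConj L) v) (cmLocalForm L 3 v)) → ↥(unitaryGroupOfForm (conjLocal L (IsCMField.complexConj L) v) (cmLocalForm L 3 v)) ⧸ Subgroup.center ↥(unitaryGroupOfForm (conjLocal L (IsCMField.complexConj L) v) (cmLocalForm L 3 v))) '' DoubleCoset.doubleCoset (𝓘.a ^ m) (𝓘.K n : Set ↥(unitaryGroupOfForm (conjLocal L (IsCMField.complexConj L) v) (cmLocalForm L 3 v))) (𝓘.K n))) →
            (∀ k : ↥(unitaryGroupOfForm (conjLocal L (IsCMField.complexConj L) v) (cmLocalForm L 3 v)), k ∈ K₀ ↔ ((((localNonsplitEquiv (IsCMField.complexConj L) (Rogawski1990.qsForm L) (IsCMField.complexConj_ne_one L) w hw) k : ↥(unitaryGroupOfForm (galAdicCompletionMap (L := L) (IsCMField.complexConj L) hw) (placeForm (Rogawski1990.qsForm L) w.1))) : GL (Fin 3) (w.1.adicCompletion L)) ∈ glInt 3 (w.1.adicCompletion L))) →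
            ∀ m : ℕ, 1 ≤ m → ∀ (hbM : z * 𝓘.a ^ m ∈ (cmBorelTriple L 3 v).M),
              𝔇.up (𝔇.packetCharH {πSt}) ((z * 𝓘.a ^ m : ↥(unitaryGroupOfForm (conjLocal L (IsCMField.complexConj L) v) (cmLocalForm L 3 v))) : Gqs L v) =
                ((rootDeltaChar (cmBorelTriple L 3 v).P (Subgroup.inclusion (cmBorelTriple L 3 v).M_le ⟨z * 𝓘.a ^ m, hbM⟩) : ℂˣ) : ℂ) *
                  (((cmXiTorusChar L v (μ.semilocalComponent L v) (torusLocalComponent L (IsCMField.complexConj L) v ξ.η) (torusLocalComponent L (IsCMField.complexConj L) v ξ.ψ)) ⟨z * 𝓘.a ^ m, hbM⟩ : ℂˣ) : ℂ) := by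
  intro L _ _ _ μ ξ v hns hμu hμω _ _ _ _ νHv νQv _ _ _ _ mHv mQv hcH hcQ hTv π₁ πSt hlab hπ₁ _ _ 𝔇 hμG hμH hreg hTr hρ hUp hρB hHCH hUpReg
    𝓘 z hzc w hw α hα0 hα1 ha K₀ hK₀c hK₀o hZK₀ hKK₀ hnormK₀ haN haNbar hexh huniq hdisj hK₀E m hm hbM
  -- the organ's Borel quotient σ-algebras, re-installed as local instances (as in ★ ₄)
  letI : ∀ γ : Gqs L v, MeasurableSpace (Gqs L v ⧸ Subgroup.centralizer ({γ} : Set (Gqs L v))) := fun _ => borel _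
  haveI : ∀ γ : Gqs L v, BorelSpace (Gqs L v ⧸ Subgroup.centralizer ({γ} : Set (Gqs L v))) := fun _ => ⟨rfl⟩
  -- ═══ (1) the (S-X)′ organ at this package: a neighbourhood `U` of `1` below which every level carries a transfer `f^H` of the shell with its trace value ═══
  obtain ⟨U, hU, hXIG⟩ := F0P3cStCharTSXIGAssembly.stXIGSt' L μ ξ v hns hμu hμω νHv νQv mHv mQv hcH hcQ hTv π₁ πSt hlab hπ₁
    𝓘 z hzc w hw α hα0 hα1 ha K₀ hK₀c hK₀o hZK₀ hKK₀ hnormK₀ haN haNbar hexh huniq hdisj hK₀E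
  set b : ↥(unitaryGroupOfForm (conjLocal L (IsCMField.complexConj L) v) (cmLocalForm L 3 v)) := z * 𝓘.a ^ m with hbdef
  -- ═══ (2) `b := z·𝓘.aᵐ` is REGULAR: its `w`-trace `β(αᵐ + 1 + (σ_w α)⁻ᵐ)` has valuation `|α|_w⁻ᵐ > 1` (★ B-DIAG + ★ `one_lt_v_add_add_iff`), so `b ∈ hyperbolicSet ⊆ G^{reg}` ═══
  obtain ⟨β, hzβ, hβ, -⟩ := F0P3cStCharTSGShellData.exists_coe_localNonsplitEquiv_eq_smul_one_of_mem_center L v w hw hzc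
  have hmap := F0P3cStCharTSBaseDiag.map_coe_central_mul_ray_pow L v w hw hzβ ha m
  have hvα0 : Valued.v α ≠ 0 := (Valuation.ne_zero_iff _).2 hα0
  have hσv : Valued.v ((galAdicCompletionMap (L := L) (IsCMField.complexConj L) hw) α) = Valued.v α :=
    valued_galAdicCompletionMap (L := L) (IsCMField.complexConj L) hw α
  have hm0 : m ≠ 0 := Nat.one_le_iff_ne_zero.1 hm
  have htr : (Pi.evalRingHom (fun w' : PlacesOver L v => w'.1.adicCompletion L) w)
      (Matrix.trace (((b : GL (Fin 3) (LocalRing L v)) : Matrix (Fin 3) (Fin 3) (LocalRing L v)))) =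
        β * α ^ m + β + β * ((galAdicCompletionMap (L := L) (IsCMField.complexConj L) hw) α)⁻¹ ^ m := by
    rw [AddMonoidHom.map_trace, hbdef, hmap, Matrix.trace_fin_three]
    simp [Matrix.diagonal_apply_eq]
  have hvtr : 1 < Valued.v ((Pi.evalRingHom (fun w' : PlacesOver L v => w'.1.adicCompletion L) w)
      (Matrix.trace (((b : GL (Fin 3) (LocalRing L v)) : Matrix (Fin 3) (Fin 3) (LocalRing L v))))) := by
    rw [htr]
    refine (F0P3cStCharTSHyperbolicSet.one_lt_v_add_add_iff L v (a := Valued.v α ^ m) (pow_ne_zero _ hvα0) ?_ hβ ?_).2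
      (ne_of_lt (pow_lt_one₀ zero_le hα1 hm0))
    · rw [map_mul, map_pow, hβ, one_mul]
    · rw [map_mul, map_pow, map_inv₀, hσv, hβ, one_mul, inv_pow]
  have hbreg : ((b : ↥(unitaryGroupOfForm (conjLocal L (IsCMField.complexConj L) v) (cmLocalForm L 3 v))) : Gqs L v) ∈ 𝔇.regG :=
    (hreg _).2 (F0P3cStCharTSHyperbolicCore.mem_hyperbolicSet_of_one_lt_v_trace L v hns w _ hvtr).2
  -- ═══ (3) (UPR): `χ_ρ^G` is locally constant at `b`; a level whose shell lies in the constancy neighbourhood and below `U` (★ CAP's shrinking lemma) ═══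
  obtain ⟨W, hW, hΘW⟩ := ((hUpReg {πSt} hρ).2 _ hbreg).exists_mem
  obtain ⟨n, hnU, hnW⟩ := F0P3cStCharTSCasselmanCap.exists_level_doubleCoset_subset (cmBorelTriple L 3 v) 𝓘 b hW hU
  -- ═══ (4) a left transversal of `K_n ∕ (K_n ∩ ᵇK_n)` and the (S-X)′ transfer at that level ═══
  obtain ⟨R, hR⟩ := Representation.exists_isLeftTransversal_conj (𝓘.isCompact_K n) (𝓘.isOpen_K n) b
  obtain ⟨fH, hfH, htrans, hval⟩ := hXIG n hnU m hm hbM R hR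
  -- ═══ (5) `UpSpecLB` (clause 3 under `hρB`) at the transfer pair + (M1H) at the singleton packet: `∫ 𝟙_{K_n b K_n}·χ_ρ^G dν = ∫ f^H·χ_ρ dν_H = Tr πSt(f^H)` (★ ₄'s (HM) block) ═══
  obtain ⟨hmeasH, hliH, hstH, -, htrH⟩ := hHCH {πSt} hρ
  obtain ⟨-, -, hupId⟩ := hUp (𝔇.packetCharH {πSt}) hmeasH hstH
  set D : Set ↥(unitaryGroupOfForm (conjLocal L (IsCMField.complexConj L) v) (cmLocalForm L 3 v)) :=
    DoubleCoset.doubleCoset b (𝓘.K n : Set ↥(unitaryGroupOfForm (conjLocal L (IsCMField.complexConj L) v) (cmLocalForm L 3 v))) (𝓘.K n) with hDdef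
  have hDo : IsOpen D := (𝓘.isOpen_K n).mul_left
  have hDc : IsCompact D := ((𝓘.isCompact_K n).mul isCompact_singleton).mul (𝓘.isCompact_K n)
  -- the shell read on the organ carrier `Gqs L v` (same set, same topology ∕ σ-algebra — pinned once, as in ★ SHELLS-TT)
  have hDoG : @IsOpen (Gqs L v) _ D := hDo
  have hDm : @MeasurableSet (Gqs L v) _ D := hDoG.measurableSet
  set φ : Gqs L v → ℂ := D.indicator (fun _ => (1 : ℂ)) with hφdef
  have hφ : IsLocSmooth φ := isLocSmooth_indicator hDo hDc.isClosed hDc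
  have h1 : πSt.smoothTrace νHv fH = ∫ h, fH h * 𝔇.packetCharH {πSt} h ∂𝔇.μH := by
    have h := htrH fH hfH
    rw [Finset.sum_singleton, hμH] at h
    rw [hμH]; exact h
  have hintG : Integrable (fun g => φ g * 𝔇.up (𝔇.packetCharH {πSt}) g) 𝔇.μG := by
    simpa only [smul_eq_mul] using (hUpReg {πSt} hρ).1.integrable_smul_left_of_hasCompactSupport hφ.1.continuous hφ.2
  have hintH : Integrable (fun h => fH h * 𝔇.packetCharH {πSt} h) 𝔇.μH := by
    simpa only [smul_eq_mul] using hliH.integrable_smul_left_of_hasCompactSupport hfH.1.continuous hfH.2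
  have h2 := hupId hρB φ hφ fH ((hTr φ fH).mpr htrans) hintG hintH
  have hkey : ∫ g, φ g * 𝔇.up (𝔇.packetCharH {πSt}) g ∂νQv = πSt.smoothTrace νHv fH := by
    rw [h1, ← h2, hμG]
  -- ═══ (6) the same integral by local constancy: `= ν(K_n b K_n)·χ_ρ^G(b)` (★ CAP `integral_indicator_mul_eq_of_eqOn`), and the shell mass `ν(K_n b K_n) = #R·ν(K_n)` (★ SHELLS-TT) ═══
  have hconst : ∫ g, φ g * 𝔇.up (𝔇.packetCharH {πSt}) g ∂νQv =
      (νQv.real D : ℂ) * 𝔇.up (𝔇.packetCharH {πSt}) ((b : ↥(unitaryGroupOfForm (conjLocal L (IsCMField.complexConj L) v) (cmLocalForm L 3 v))) : Gqs L v) :=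
    F0P3cStCharTSCasselmanCap.integral_indicator_mul_eq_of_eqOn νQv hDm _ _ (fun g hg => hΘW g (hnW hg))
  have hone : ∫ g, φ g * (fun _ : Gqs L v => (1 : ℂ)) g ∂νQv = (νQv.real D : ℂ) * (fun _ : Gqs L v => (1 : ℂ)) ((b : ↥(unitaryGroupOfForm (conjLocal L (IsCMField.complexConj L) v) (cmLocalForm L 3 v))) : Gqs L v) :=
    F0P3cStCharTSCasselmanCap.integral_indicator_mul_eq_of_eqOn νQv hDm (fun _ : Gqs L v => (1 : ℂ)) ((b : ↥(unitaryGroupOfForm (conjLocal L (IsCMField.complexConj L) v) (cmLocalForm L 3 v))) : Gqs L v) (fun _ _ => rfl)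
  simp only [mul_one] at hone
  have hmass : ∫ g, φ g ∂νQv = (R.card : ℂ) * ((νQv.real ((𝓘.K n : Set ↥(unitaryGroupOfForm (conjLocal L (IsCMField.complexConj L) v) (cmLocalForm L 3 v))) : Set (Gqs L v)) : ℝ) : ℂ) :=
    F0P3cStCharTSShellsTT.integral_indicator_doubleCoset L v νQv (𝓘.K n) (𝓘.isOpen_K n) b hR
  rw [hmass] at hone
  rw [← hone] at hconst
  -- ═══ (7) compare with the (S-X)′ value and cancel `#R·ν(K_n) ≠ 0` (★ CONSTANTS) ═══
  rw [hconst, hval] at hkey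
  have hK : ((νQv.real ((𝓘.K n : Set ↥(unitaryGroupOfForm (conjLocal L (IsCMField.complexConj L) v) (cmLocalForm L 3 v))) : Set (Gqs L v)) : ℝ) : ℂ) ≠ 0 :=
    F0P3cStCharTSConstants.ofReal_measureReal_coe_subgroup_ne_zero νQv (𝓘.K n) (𝓘.isOpen_K n) (𝓘.isCompact_K n)
  have hRc : (R.card : ℂ) ≠ 0 := F0P3cStCharTSConstants.natCast_card_ne_zero_of_isLeftTransversal hR
  have hcancel : ∀ {x d c : ℂ},
      (R.card : ℂ) * ((νQv.real ((𝓘.K n : Set ↥(unitaryGroupOfForm (conjLocal L (IsCMField.complexConj L) v) (cmLocalForm L 3 v))) : Set (Gqs L v)) : ℝ) : ℂ) * x =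
        ((νQv.real ((𝓘.K n : Set ↥(unitaryGroupOfForm (conjLocal L (IsCMField.complexConj L) v) (cmLocalForm L 3 v))) : Set (Gqs L v)) : ℝ) : ℂ) * (R.card : ℂ) * d * c → x = d * c :=
    fun h => mul_left_cancel₀ (mul_ne_zero hRc hK) (by rw [h]; ring)
  exact hcancel hkey

end Summit.HodgeConjecture.HodgeConjecture.Cruxes.H413.F0P3cStCharTSUpValue

end
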